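import Summits.HodgeConjecture.HodgeConjecture.Theorems.F0P3CMFrameOrbit
import Summits.HodgeConjecture.HodgeConjecture.Theorems.F0P2aL2bHolLieSpanPackage
import Literature.NumberTheory.Automorphic.AutomorphicAnalyticVectorsGeneral
import HarnessLib

/-!
# FLOOR-0 P3 — rung-1 brick B1′ (analytic preliminaries): the `L²`-LIE-STABLE SPAN of the coordinates of a holomorphic cotangent
# form of the CM unitary group, and the `L²`-derivatives of its orbits in both frames

Cell hodgecm-mathlib, FLOOR 0, crux item H413 = stmt-HodgeConjecture-24833; brief B1′ of the P3 integrator (F0P3-plan (g0)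
2026-08-31T00:17:32Z; ENGINE-INTERFACES §7k/§7l), author F0P3-p01 (g3).  PROOF lane (no `def`, no instance, no named fact).
Consumed by `Theorems/F0P3CotangentFormValueMap.lean`.

SETTING.  The CM frame `(L, ι, H, T, hT)` of ★ `UnitaryGroupCohomologicalForms` §5 (`𝒢 = adelicGroupData L⁺ L c̄ 3 H`,
`cmArchSection : U21 →* U(H)(𝔸_{L⁺})`, `cmCompactFactor`), an automorphic measure `μ` on the COMPACT automorphic quotient, and
`Φ ∈ holCotForms L⁺ L c̄ 3 H cmArchSection cmCompactFactor`.
* `memLp_toQuotFun_apply` ∕ `memLp_toQuotFun_lieDeriv`: the coordinates of `Φ` and their Lie derivatives along `𝔲(2,1)` have `L²`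
  descents (continuous, left-invariant — ★ `F0P2aL2bHolLieSpanPackage.iterLieDeriv_hol_package`, ★ `memLp_toQuotFun`);
* `isL2LieStable_span`: the `U(𝔤)`-span `S(Φ)` of the coordinates is an `L²`-LIE-STABLE space (★ `IsL2LieStable`) for the local
  archimedean automorphy datum `(u21Group, cmArchSection)` (the datum is a structure literal inside the statements, as in ★
  `F0P2aL2cOrderedProducts` and ★ `U21AnalyticVectors`; never a definition);
* `hasDerivAt_rightRegular_cl` ∕ `hasDerivAt_rightRegular_cl_uForm`: the `L²`-derivative of the orbit `t ↦ R(ι_∞(exp tX))[ψ]` of the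
  class of `ψ ∈ S(Φ)` is `[X ψ]` (★ `IsL2LieStable.hasDerivAt_rightRegular_cl_lieHom`), along the ball-model section and, through ★
  `F0P3CMFrameOrbit.cmArchSectionUForm_expMem_smul`, along `cmArchSectionUForm` in the engine frame `U(2,1)_{Fin 2 ⊕ Fin 1}`.

References: Harish-Chandra 1953, §7, §9 [HarishChandra1953]; Borel–Jacquet 1979, §1.5, §4.2, §4.6 [BorelJacquetCorvallis1979].
HONEST LABEL: HC_CM is proved only modulo the printed citations until rung 0 closes; this file discharges none of them.
-/

-- Mathlib idiom (as in ★ `GKModules` and every `(𝔤, K)` file of the tree): commutator bracket on `Module.End` / matrices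
attribute [local instance 100] LieRing.ofAssociativeRing

-- The scoped `L^∞`-operator normed structure on matrices agrees with the product topology only up to non-reducible
-- unfolding (cf. `Matrix.exp_add_of_commute` in Mathlib and ★ `GKModulesSmoothVectorsProofs`).
set_option backward.isDefEq.respectTransparency false

set_option autoImplicit false
set_option linter.dupNamespace false

noncomputable section

open scoped Matrix MatrixGroups ComplexConjugate ENNReal
open NumberField MeasureTheory MulAction

namespace Summit.HodgeConjecture.HodgeConjecture.Cruxes.H413.F0P3CotangentFormL2Span

open Literature.NumberTheory.Automorphic Literature.NumberTheory.Automorphic.UnitaryGroup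
open Literature.NumberTheory.Automorphic.UnitaryGroup.CotangentForms
open Literature.RepresentationTheory.KonnoKonno2007 Literature.RepresentationTheory.KonnoKonno2007.RealDualPair
open Literature.RepresentationTheory.BorelWallach2000
open Literature.Geometry.ComplexHyperbolic.BallModel (U21 J)
open Literature.AlgebraicGeometry.ShimuraVarieties.BallForms (u21Group liePMat)
open Summit.HodgeConjecture.HodgeConjecture.Cruxes.H413.F0P2aL2cOrderedProducts
open Summit.HodgeConjecture.HodgeConjecture.Cruxes.H413.F0P2aL2bHolLieSpanPackage
open Summit.HodgeConjecture.HodgeConjecture.Cruxes.H413.F0P3CMFrameOrbit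

variable {L : Type} [Field L] [NumberField L] [IsCMField L] (ι : L →+* ℂ) {H : Matrix (Fin 3) (Fin 3) L}
  (T : GL (Fin 3) ℂ) (hT : (T : Matrix (Fin 3) (Fin 3) ℂ)ᴴ * H.map ι * (T : Matrix (Fin 3) (Fin 3) ℂ) = J)
  {μ : Measure (adelicGroupData (↥(maximalRealSubfield L)) L (IsCMField.complexConj L) 3 H).automorphicQuotient}
  [(adelicGroupData (↥(maximalRealSubfield L)) L (IsCMField.complexConj L) 3 H).IsAutomorphicMeasure μ]
  [CompactSpace (adelicGroupData (↥(maximalRealSubfield L)) L (IsCMField.complexConj L) 3 H).automorphicQuotient]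
  {Φ : (adelicGroupData (↥(maximalRealSubfield L)) L (IsCMField.complexConj L) 3 H).Adelic → (Fin 2 → ℂ)}

/-! ## §1 `L²` descents of the coordinates and their Lie derivatives; the `L²`-Lie-stable span -/

/-- The coordinates of a holomorphic cotangent form on a COMPACT quotient have `L²` descents (continuous, left-invariant; ★
`memLp_toQuotFun`). [cite: BorelJacquetCorvallis1979, §4.2 and §4.6] -/
theorem memLp_toQuotFun_apply
    (hΦ : Φ ∈ holCotForms (↥(maximalRealSubfield L)) L (IsCMField.complexConj L) 3 H (cmArchSection L ι H T hT)
      (cmCompactFactor L ι H T hT)) (j : Fin 2) :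
    MemLp (toQuotFun (adelicGroupData (↥(maximalRealSubfield L)) L (IsCMField.complexConj L) 3 H) fun x => Φ x j) 2 μ := by
  obtain ⟨-, h2, -, -, -, h6⟩ := iterLieDeriv_hol_package hΦ [] j
  exact SpectrumJunction.memLp_toQuotFun h2 h6 2

/-- The Lie derivatives of the coordinates along `𝔲(2,1)` have `L²` descents. [cite: BorelJacquetCorvallis1979, §1.5 and §4.6] -/
theorem memLp_toQuotFun_lieDeriv
    (hΦ : Φ ∈ holCotForms (↥(maximalRealSubfield L)) L (IsCMField.complexConj L) 3 H (cmArchSection L ι H T hT)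
      (cmCompactFactor L ι H T hT)) (X : u21Group.lie) (j : Fin 2) :
    MemLp (toQuotFun (adelicGroupData (↥(maximalRealSubfield L)) L (IsCMField.complexConj L) 3 H)
      (lieDeriv (H := u21Group) (cmArchSection L ι H T hT) X fun x => Φ x j)) 2 μ := by
  obtain ⟨-, h2, -, -, -, h6⟩ := iterLieDeriv_hol_package hΦ [X] j
  exact SpectrumJunction.memLp_toQuotFun h2 h6 2

/-- **The `U(𝔤)`-span `S(Φ)` of the coordinates of `Φ` is an `L²`-LIE-STABLE space** (★ `IsL2LieStable`) for the local archimedean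
automorphy datum `(u21Group, cmArchSection)`: arch-smooth, Lie-stable, `L²`-representable, injective class map (★
`F0P2aL2bHolLieSpanPackage`). [cite: HarishChandra1953, §7 (p. 209)] [cite: BorelJacquetCorvallis1979, §4.6] -/
theorem isL2LieStable_span
    (hΦ : Φ ∈ holCotForms (↥(maximalRealSubfield L)) L (IsCMField.complexConj L) 3 H (cmArchSection L ι H T hT)
      (cmCompactFactor L ι H T hT)) :
    IsL2LieStable
      ({ arch := u21Group, ofArch := cmArchSection L ι H T hT, continuous_ofArch := continuous_archSectionU21CM L ι H T hT,
         finiteAdelic := ⊥,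
         commute_ofArch := fun g h hh => by rw [Subgroup.mem_bot] at hh; rw [hh, mul_one, one_mul],
         finiteLevels := {⊥}, finiteLevels_nonempty := Set.singleton_nonempty ⊥,
         le_finiteAdelic := fun U hU => le_of_eq (Set.mem_singleton_iff.1 hU), height := fun _ => 0 } :
        AutomorphyDatum (adelicGroupData (↥(maximalRealSubfield L)) L (IsCMField.complexConj L) 3 H) ℂ (Fin 3)) μ
      (Submodule.span ℂ (Set.range fun p : List u21Group.lie × Fin 2 =>
        iterLieDeriv (H := u21Group) (cmArchSection L ι H T hT) p.1 fun x => Φ x p.2)) where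
  smooth := fun _ hψ => span_iterLieDeriv_hol_isArchSmooth hΦ hψ
  lie_mem := fun X _ hψ => span_iterLieDeriv_hol_lieDeriv_mem hΦ X hψ
  le_l2Representable := span_iterLieDeriv_hol_le_l2Representable hΦ
  eq_zero_of_l2ClassOf_eq_zero := fun _ hψ h0 =>
    span_iterLieDeriv_hol_injective hΦ hψ _ ((adelicGroupData (↥(maximalRealSubfield L)) L (IsCMField.complexConj L) 3 H).memLp_l2Rep _)
      ((adelicGroupData (↥(maximalRealSubfield L)) L (IsCMField.complexConj L) 3 H).invQuot_l2Rep _) h0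

omit [CompactSpace (adelicGroupData (↥(maximalRealSubfield L)) L (IsCMField.complexConj L) 3 H).automorphicQuotient] in
/-- **The `L²`-derivative of an orbit of a class of `S(Φ)` along the ball-model section** (★ `hasDerivAt_rightRegular_cl_lieHom`
at the local datum `(u21Group, cmArchSection)`, with the datum's projections unfolded). [cite: HarishChandra1953, §9 (p. 227)] -/
theorem hasDerivAt_rightRegular_cl {W : Submodule ℂ ((adelicGroupData (↥(maximalRealSubfield L)) L (IsCMField.complexConj L) 3 H).Adelic → ℂ)}
    (hW : IsL2LieStable
        ({ arch := u21Group, ofArch := cmArchSection L ι H T hT, continuous_ofArch := continuous_archSectionU21CM L ι H T hT,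
           finiteAdelic := ⊥,
           commute_ofArch := fun g h hh => by rw [Subgroup.mem_bot] at hh; rw [hh, mul_one, one_mul],
           finiteLevels := {⊥}, finiteLevels_nonempty := Set.singleton_nonempty ⊥,
           le_finiteAdelic := fun U hU => le_of_eq (Set.mem_singleton_iff.1 hU), height := fun _ => 0 } :
          AutomorphyDatum (adelicGroupData (↥(maximalRealSubfield L)) L (IsCMField.complexConj L) 3 H) ℂ (Fin 3)) μ W)
    (ρ : u21Group.lie →ₗ⁅ℝ⁆ Module.End ℂ W)
    (hρ : ∀ (X : u21Group.lie) (φ : W), ((ρ X φ : W) : (adelicGroupData (↥(maximalRealSubfield L)) L (IsCMField.complexConj L) 3 H).Adelic → ℂ) = lieDeriv (H := u21Group) (cmArchSection L ι H T hT) X φ)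
    (X : u21Group.lie) (ψ : W) :
    HasDerivAt (fun t : ℝ => (adelicGroupData (↥(maximalRealSubfield L)) L (IsCMField.complexConj L) 3 H).rightRegular μ (cmArchSection L ι H T hT (u21Group.expMem (t • X))) (hW.cl ψ)) (hW.cl (ρ X ψ)) 0 :=
  hW.hasDerivAt_rightRegular_cl_lieHom ρ hρ X ψ

omit [CompactSpace (adelicGroupData (↥(maximalRealSubfield L)) L (IsCMField.complexConj L) 3 H).automorphicQuotient] in
/-- The same orbit read in the `Fin 2 ⊕ Fin 1` frame: `d/dt R(cmArchSectionUForm (exp tY)) [ψ] |₀ = [Y♭ ψ]` (★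
`cmArchSectionUForm_expMem_smul`). [cite: HarishChandra1953, §9 (p. 227)] -/
theorem hasDerivAt_rightRegular_cl_uForm {W : Submodule ℂ ((adelicGroupData (↥(maximalRealSubfield L)) L (IsCMField.complexConj L) 3 H).Adelic → ℂ)}
    (hW : IsL2LieStable
        ({ arch := u21Group, ofArch := cmArchSection L ι H T hT, continuous_ofArch := continuous_archSectionU21CM L ι H T hT,
           finiteAdelic := ⊥,
           commute_ofArch := fun g h hh => by rw [Subgroup.mem_bot] at hh; rw [hh, mul_one, one_mul],
           finiteLevels := {⊥}, finiteLevels_nonempty := Set.singleton_nonempty ⊥,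
           le_finiteAdelic := fun U hU => le_of_eq (Set.mem_singleton_iff.1 hU), height := fun _ => 0 } :
          AutomorphyDatum (adelicGroupData (↥(maximalRealSubfield L)) L (IsCMField.complexConj L) 3 H) ℂ (Fin 3)) μ W)
    (ρ : u21Group.lie →ₗ⁅ℝ⁆ Module.End ℂ W)
    (hρ : ∀ (X : u21Group.lie) (φ : W), ((ρ X φ : W) : (adelicGroupData (↥(maximalRealSubfield L)) L (IsCMField.complexConj L) 3 H).Adelic → ℂ) = lieDeriv (H := u21Group) (cmArchSection L ι H T hT) X φ)
    (Y : (uFormGroup (Fin 2) (Fin 1)).lie) (Y' : u21Group.lie)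
    (hY : (Y' : Matrix (Fin 3) (Fin 3) ℂ) = Matrix.reindex (finSumFinEquiv : Fin 2 ⊕ Fin 1 ≃ Fin 3) finSumFinEquiv
      (Y : Matrix (Fin 2 ⊕ Fin 1) (Fin 2 ⊕ Fin 1) ℂ)) (ψ : W) :
    HasDerivAt (fun t : ℝ => (adelicGroupData (↥(maximalRealSubfield L)) L (IsCMField.complexConj L) 3 H).rightRegular μ (cmArchSectionUForm L ι H T hT ((uFormGroup (Fin 2) (Fin 1)).expMem (t • Y)))
      (hW.cl ψ)) (hW.cl (ρ Y' ψ)) 0 := by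
  have hfun : (fun t : ℝ => (adelicGroupData (↥(maximalRealSubfield L)) L (IsCMField.complexConj L) 3 H).rightRegular μ (cmArchSectionUForm L ι H T hT ((uFormGroup (Fin 2) (Fin 1)).expMem (t • Y)))
      (hW.cl ψ)) = fun t : ℝ => (adelicGroupData (↥(maximalRealSubfield L)) L (IsCMField.complexConj L) 3 H).rightRegular μ (cmArchSection L ι H T hT (u21Group.expMem (t • Y'))) (hW.cl ψ) := by
    funext t
    rw [cmArchSectionUForm_expMem_smul L ι H T hT Y Y' hY t]
  rw [hfun]
  exact hasDerivAt_rightRegular_cl ι T hT hW ρ hρ Y' ψ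

end Summit.HodgeConjecture.HodgeConjecture.Cruxes.H413.F0P3CotangentFormL2Span

end
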